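import Summits.BirchSwinnertonDyer.BirchSwinnertonDyer.Theorems.BiquadraticEisensteinDescentEisensteinDivisibilityCMInertBadFlatAtOneOfFacts
import Summits.BirchSwinnertonDyer.BirchSwinnertonDyer.Theorems.BiquadraticEisensteinDescentEisensteinDivisibilityCMInertBadFlatAtOneAbsIrr
import HarnessLib

set_option linter.dupNamespace false -- `Summit.BirchSwinnertonDyer.BirchSwinnertonDyer.Theorems.…` (summit = sub)
set_option autoImplicit false

/-!
# Crux (E♭°) `EisensteinDivisibilityCMInertBadFlatAtOne` (stmt-BirchSwinnertonDyer-20452), line `birth`: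
# the composition modulo the heart WITHOUT the (Irr) binder — crux ⟸ `stub_E1B` + (A∞) + (R) + (B) + `Odd d_K′`

Route `BiquadraticEisensteinDescent` (cell `pub/bsd-wall`, lead-prover seat `bsd-wall-bed-p1`, g3). The landed composition
`…FlatAtOneOfFacts.flatAtOne_of_stubE1B_of_facts` (p520683, g2) derives the crux's conclusion at every datum from the
research stub `stub_E1B` and the three refereed named facts (A∞) Hsieh Thm. A at any level, (R) BDP13 central-value
reciprocity, (B) Hsieh Thm. B at any level, under TWO binders the rev-8 statement lacks: `Odd (discr K′)` and (Irr)
(every framing of `E_{K′}[p]` absolutely irreducible — hypothesis (2) of Hsieh's Thm. B). The second binder is now a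
THEOREM of the tree (`…FlatAtOneAbsIrr.absIrrModPBaseChangeCMInert`, g3: two Frobenius elements of `Γ_{K′}`), so this
file records the sharper net position of line `birth`:

* `flatAtOne_of_stubE1B_of_facts_odd` — `(A∞) → (R) → (B) → stub_E1B → ∀ <the binders of the crux VERBATIM, with ONLY
  Odd (discr K′) inserted after the Heegner binder>, <the crux's conclusion VERBATIM>`.

So, as typed, the rev-8 item is short of exactly ONE binder (`Odd (NumberField.discr K′)`, supplied by the K′-supply
item in the planner's rev-9 draft) and three published antecedents for its proof to reduce to `stub_E1B` (family-B
Eisenstein divisibility at tame `p`-level — NOT IN PRINT: Hsieh JAMS 2014 Thm. 2 hypothesis (2) fails for `ψ_L`). The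
hypothesis `hE1B` is the REGISTERED stub's statement verbatim; nothing is asserted about it.

THEOREMS ONLY (no definition, no named fact, no `sorry`); CONDITIONAL on (A∞), (R), (B) and `hE1B` (open). Supports,
does not close, stmt-BirchSwinnertonDyer-20452.

References: [Hsieh2014] Thm. A, Thm. B (Doc. Math. 19 p. 712); [BertoliniDarmonPrasanna2013] Thm. 5.5;
[Castella2018] Thm. 3.1 (arXiv:1704.06608 p. 9).
-/

noncomputable section

open scoped Classical NumberField

open PowerSeries NumberField IsDedekindDomain Field WeierstrassCurve
  Literature.NumberTheory.EllipticCurves Literature.NumberTheory.EllipticCurves.ModularForms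
  Literature.NumberTheory.EllipticCurves.Rank1Residual
  Literature.NumberTheory.GaloisRepresentations Literature.NumberTheory.Automorphic
  Literature.NumberTheory.EllipticCurves.Hsieh2014
  Summit.BirchSwinnertonDyer.Rank1Residual.X11b
  Summit.BirchSwinnertonDyer.Rank1Residual.X11b.AcSelmer Summit.BirchSwinnertonDyer.Rank1Residual.X11b.Halves
  Summit.BirchSwinnertonDyer.BirchSwinnertonDyer.Theorems.BiquadraticEisensteinDescentEisensteinDivisibilityCMInertBadFlatAtOneOfFacts
  Summit.BirchSwinnertonDyer.BirchSwinnertonDyer.Theorems.BiquadraticEisensteinDescentEisensteinDivisibilityCMInertBadFlatAtOneAbsIrr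

namespace Summit.BirchSwinnertonDyer.BirchSwinnertonDyer.Theorems.BiquadraticEisensteinDescentEisensteinDivisibilityCMInertBadFlatAtOneOfFactsIrr

/-- **Crux (E♭°) modulo its heart, (Irr) discharged.** From (A∞) Hsieh Thm. A at any level, (R) BDP13 central-value
reciprocity, (B) Hsieh Thm. B at any level and the registered research stub `stub_E1B` (verbatim, as the hypothesis
`hE1B`): at every datum of the crux `EisensteinDivisibilityCMInertBadFlatAtOne` — binders VERBATIM — that ALSO
satisfies `Odd (discr K′)`, the crux's conclusion holds (the constant terms of `Ch_Λ(X_ac(W/K′), strict at 𝔭′)` lie in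
`Q(𝟙)·𝓞_{ℂ_p}`). This is `flatAtOne_of_stubE1B_of_facts` (p520683) with its (Irr) binder supplied by the theorem
`absIrrModPBaseChangeCMInert` (CM, `p ≥ 5` inert and bad, `K′` Heegner ⟹ every framing of `E_{K′}[p]` is absolutely
irreducible). CONDITIONAL on (A∞), (R), (B) and on `hE1B` (OPEN).
[cite: Hsieh2014, Thm. A and Thm. B p. 712 (Doc. Math. 19)] [cite: BertoliniDarmonPrasanna2013, Thm. 5.5 (p. 60)]
[cite: Castella2018, Thm. 3.1 (arXiv:1704.06608 p. 9)] -/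
theorem flatAtOne_of_stubE1B_of_facts_odd
    (hA : thmA_exists_isHsiehLFunction_unrPeriod_anyLevel)
    (hR : bertoliniDarmonPrasanna2013_centralValue_reciprocity)
    (hB : thmB_exists_isHsiehLFunction_coeff_norm_eq_one_unrPeriod_anyLevel)
    (hE1B : ∀ (W : WeierstrassCurve ℚ) [W.IsElliptic] [W.IsGloballyMinimal] (p : ℕ) [Fact p.Prime]
      [NeZero (W.conductorNorm ℤ)] (K : Type) [Field K] [NumberField K],
      W.HasCM → W.analyticRank = 1 → 5 ≤ p → CMInert W p → ¬ Good W p →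
      IsImaginaryQuadratic K → SatisfiesHeegnerHypothesis (W.conductorNorm ℤ) K →
      4 < (NumberField.discr K).natAbs →
      (∀ (M : Type) [Field M] [NumberField M], Module.finrank ℚ M = 4 →
        (∃ x : M, x ^ 2 = ((cmFieldDiscrOfJ W.j : ℤ) : M)) → (∃ y : M, y ^ 2 = ((NumberField.discr K : ℤ) : M)) →
        ¬ p ∣ NumberField.classNumber M) →
      (W.quadraticTwist (NumberField.discr K : ℚ)).entireLFunction 1 ≠ 0 →
      ∀ (κ : ZpExtension K p), κ.IsAnticyclotomic →
        ∀ (γ : Field.absoluteGaloisGroup K) [Fact (κ.IsTopGenerator γ)]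
          (𝔭 : HeightOneSpectrum (𝓞 K)), ((p : ℕ) : 𝓞 K) ∈ 𝔭.asIdeal →
          𝔭.asIdeal.ramificationIdx (𝓞 ℚ) = 1 → 𝔭.asIdeal.inertiaDeg (𝓞 ℚ) = 1 →
          ∀ (f : CuspForm (CongruenceSubgroup.Gamma0 (W.conductorNorm ℤ)) 2), IsNewformOf W f →
            ∀ (ι' : PadicAlgCl p ≃+* ℂ),
              (∀ (w : InfinitePlace K) (k : 𝓞 K), k ∈ 𝔭.asIdeal ↔ ‖ι'.symm (w.embedding (k : K))‖ < 1) →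
              ∀ (ΩK : ℂ) (Ωp : (unrIntegers p)ˣ) (L : UnrSeries p), ΩK ≠ 0 →
                IsBDPLFunction ι' 𝔭 κ γ f ΩK ((Ωp : unrIntegers p) : ℂ_[p]) L →
                  ∀ (𝔭' : HeightOneSpectrum (𝓞 K)), ((p : ℕ) : 𝓞 K) ∈ 𝔭'.asIdeal → 𝔭' ≠ 𝔭 →
                  ∃ m : ℕ, ∀ x ∈ (XAc.charIdeal (W.baseChange K) p κ 𝔭' ∅ γ).map (PowerSeries.map (toUnr p)),
                    (PowerSeries.C ((p : ℕ) : unrIntegers p) : UnrSeries p) ^ m * x ∈ Ideal.span {L}) :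
  ∀ (W : WeierstrassCurve ℚ) [W.IsElliptic] [W.IsGloballyMinimal] (p : ℕ) [Fact p.Prime]
    [NeZero (W.conductorNorm ℤ)] (K : Type) [Field K] [NumberField K],
    W.HasCM → W.analyticRank = 1 → 5 ≤ p → CMInert W p → ¬ Good W p →
    IsImaginaryQuadratic K → SatisfiesHeegnerHypothesis (W.conductorNorm ℤ) K →
    Odd (NumberField.discr K) →
    4 < (NumberField.discr K).natAbs →
    (∀ (L : Type) [Field L] [NumberField L], Module.finrank ℚ L = 4 →
      (∃ x : L, x ^ 2 = ((cmFieldDiscrOfJ W.j : ℤ) : L)) → (∃ y : L, y ^ 2 = ((NumberField.discr K : ℤ) : L)) →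
      ¬ p ∣ NumberField.classNumber L) →
    (W.quadraticTwist (NumberField.discr K : ℚ)).entireLFunction 1 ≠ 0 →
    ∀ (κ : ZpExtension K p), κ.IsAnticyclotomic →
      ∀ (γ : Field.absoluteGaloisGroup K) [Fact (κ.IsTopGenerator γ)]
        (𝔭 : HeightOneSpectrum (𝓞 K)), ((p : ℕ) : 𝓞 K) ∈ 𝔭.asIdeal →
        𝔭.asIdeal.ramificationIdx (𝓞 ℚ) = 1 → 𝔭.asIdeal.inertiaDeg (𝓞 ℚ) = 1 →
        ∀ (𝔭' : HeightOneSpectrum (𝓞 K)), ((p : ℕ) : 𝓞 K) ∈ 𝔭'.asIdeal → 𝔭' ≠ 𝔭 →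
        ∀ (f : CuspForm (CongruenceSubgroup.Gamma0 (W.conductorNorm ℤ)) 2), IsNewformOf W f →
          ∀ (ι' : PadicAlgCl p ≃+* ℂ),
            (∀ (w : InfinitePlace K) (k : 𝓞 K), k ∈ 𝔭.asIdeal ↔ ‖ι'.symm (w.embedding (k : K))‖ < 1) →
            ∀ (ΩK : ℂ) (Ωp : (unrIntegers p)ˣ) (Q : PowerSeries (PadicComplexInt p)), ΩK ≠ 0 →
              R1.IsBDPLFunctionInt p ι' 𝔭 κ γ f ΩK ((Ωp : unrIntegers p) : (PadicComplex p)) Q →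
                (XAc.charIdeal (W.baseChange K) p κ 𝔭' ∅ γ).map
                    ((R1.toCpInt p).comp (PowerSeries.constantCoeff : IwasawaAlgebra p →+* ℤ_[p])) ≤
                  Ideal.span {PowerSeries.constantCoeff Q} := by
  intro W _ _ p _ _ K _ _ hCM hr hp5 hin hbad hK hHN hodd hd4 hadm hLt κ hκ γ hγ 𝔭 h𝔭 he hf 𝔭' h𝔭' hne f
    hfW ι' hι' ΩK Ωp Q hΩK hQ
  exact flatAtOne_of_stubE1B_of_facts hA hR hB hE1B W p K hCM hr hp5 hin hbad hK hHN hodd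
    (absIrrModPBaseChangeCMInert W p hCM hp5 hin hbad K hK hHN) hd4 hadm hLt κ hκ γ 𝔭 h𝔭 he hf 𝔭' h𝔭' hne f
    hfW ι' hι' ΩK Ωp Q hΩK hQ

end Summit.BirchSwinnertonDyer.BirchSwinnertonDyer.Theorems.BiquadraticEisensteinDescentEisensteinDivisibilityCMInertBadFlatAtOneOfFactsIrr

end
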